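import Literature.NumberTheory.Rogawski1990.Ch9Sec1
import Literature.NumberTheory.Rogawski1990.Ch9Sec2
import Literature.NumberTheory.Rogawski1990.Ch9Sec3
import Literature.NumberTheory.Rogawski1990.Ch9Sec4
import Literature.NumberTheory.Rogawski1990.Ch9Sec5
import HarnessLib

/-!
# Rogawski 1990, Chapter 9 «Singularities» — BRIDGE between the parallel carpet data of §9.1–§9.3 (TR-t05: `U2SingularityData`,
# `U3SingularityData`, `RealSingularityData`) and of §9.4–§9.5 (TR-t12: `SplitSingularityData`, `TwistedSingularityData`): the smoothness
# vocabularies and the `S𝔍`-shape of the twisted expression (9.5.1) — THEOREMS ONLY (kernel-checked), no new definition, no named fact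

Topic `NumberTheory/Rogawski1990`; file `Ch9Bridge.lean`, namespace `Literature.NumberTheory.Rogawski1990.Ch9Bridge` (squad TR RULING #11: a bridge
file imports only ★ files, holds `theorem`s ∕ definitional adapters, introduces NO `Prop`-valued named fact, no `sorry`, no instance, no notation).
What is reconciled, and why it is only this much: the five Chapter-9 carpets posit DIFFERENT objects (t05: the `p`-adic ∕ real germ data of `U(2)`,
`U(3)` with abstract test-function types `TG`, `TH`; t12: the split-place datum over ★ `classOrbitalIntegral` and the twisted local data), so no
field-by-field isomorphism exists; what they SHARE is (1) the reading of «smooth ∕ extends to a smooth function on `M`» and (2) the shape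
`S𝔍(γ, f) = 𝔍(γ, f) − ½ μ(γ)⁻¹ 𝔍_H(γ, f^H)` inside the twisted expression (9.5.1).  Kernel-checked here:
* `isSmoothPadic_iff` — t12's `Ch9Sec4.IsSmoothPadic` IS Mathlib's `IsLocallyConstant` (the value t05 writes inline in `Prop925Smooth`).
* `isSmoothNear_of_isSmoothPadic` — a globally smooth (`p`-adic) function is smooth near every point in t05's germ sense `Ch9Sec1.IsSmoothNear`.
* `ExtendsToSmooth.of_smooth`, `ExtendsToSmooth.mono` — bookkeeping of t12's `Ch9Sec5.ExtendsToSmooth`.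
* `extendsSmoothNear_of_extendsToSmooth` — t12's GLOBAL «extends to a smooth function on `M`» (at `Smooth := IsSmoothPadic`, `D := 𝔇.IsRegular`)
  implies t05's GERM version `U3SingularityData.ExtendsSmoothNear` at every `γ₀` (Prop. 9.2.5 ∕ 9.5.1 (a) currency ↔ Lemma 9.2.3 currency).
* `prop925Smooth_iff` — t05's PROP. 9.2.5 (last sentence) IS «`S𝔍(·, f)` `ExtendsToSmooth` (p-adic) on the regular set» in t12's currency (`Iff.rfl`).
* `prop932_extendsToSmooth`, `prop931_extendsToSmooth` — t05's PROPS. 9.3.2 ∕ 9.3.1 (archimedean, posited `IsSmooth`) give t12-style extensions.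
* `prop941_extendsToSmooth` — the same for t12's own PROP. 9.4.1 (any smoothness class).
* `localR_eq_Jt_sub_SJ` — for twisted data whose `U(3)`∕`H` weighted integrals and `μ(γ)⁻¹` AGREE with a `RealSingularityData` on the same `M` and the
  same test-function types, the expression (9.5.1) `Ch9Sec5.TwistedSingularityData.localR` equals `𝔍_ε(δ_v, φ_v) − S𝔍(γ, f) − ½ 𝔍_H(γ, φ^H)` with t05's
  `RealSingularityData.SJ` — i.e. print's definition of `R(γ, φ, v)` («`𝔍_{M̃}(δ, φ, v) − S𝔍_M(γ, f, v) − ½ S𝔍_M(γ, φ^H, v)`», §9.5 p. 149, chunk p0143,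
  with `S𝔍` for `H` being `𝔍_H`) recovered from its expanded form (9.5.1); and `localR_eq_Jt_sub_SJ'` the same over `U3SingularityData` (p-adic, §9.2's `SJ`).
Discharges rows of the squad's BRIDGES lists: «Ch9: smoothness readings t05 ↔ t12» and «(9.5.1) vs S𝔍».  HC_CM is proved only modulo the printed
citations until rung 0 closes; this file proves only definitional reconciliations, no printed statement.

References: [Rogawski1990] Ch. 9 introduction p. 134 (chunk p0131: «smooth», «germ»); §9.2 p. 141 (chunk p0137: `S𝔍`); Prop. 9.2.5 p. 141; Props.
9.3.1–9.3.2 pp. 143–144 (chunks p0138–p0139); Prop. 9.4.1 p. 147 (chunk p0141); §9.5 (9.5.1) p. 149 (chunk p0143).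
-/

noncomputable section

namespace Literature.NumberTheory.Rogawski1990.Ch9Bridge

open _root_.Topology _root_.Filter
open Literature.NumberTheory.Rogawski1990.Ch9Sec1 Literature.NumberTheory.Rogawski1990.Ch9Sec2
open Literature.NumberTheory.Rogawski1990.Ch9Sec3 Literature.NumberTheory.Rogawski1990.Ch9Sec4
open Literature.NumberTheory.Rogawski1990.Ch9Sec5

universe u u₁ u₂ u₃ v

/-! ## §1 Smoothness readings -/

section Smooth

variable {M : Type v} [TopologicalSpace M]

/-- t12's `p`-adic «smooth on `M`» IS Mathlib's `IsLocallyConstant` (the reading t05 writes inline in `U3SingularityData.Prop925Smooth`).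
[cite: Rogawski1990, Ch. 9 introduction p. 134, chunk p0131] -/
theorem isSmoothPadic_iff (F : M → ℂ) : IsSmoothPadic F ↔ IsLocallyConstant F :=
  Iff.rfl

/-- A globally locally-constant function is smooth near every point in the germ sense of `Ch9Sec1.IsSmoothNear` (take `U = univ`).
[cite: Rogawski1990, Ch. 9 introduction p. 134, chunk p0131] -/
theorem isSmoothNear_of_isSmoothPadic {F : M → ℂ} (h : IsSmoothPadic F) (γ₀ : M) : IsSmoothNear F γ₀ :=
  ⟨Set.univ, Filter.univ_mem, h.comp_continuous continuous_subtype_val⟩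

omit [TopologicalSpace M] in
/-- A function already in the smoothness class extends itself. [cite: Rogawski1990, §9.5 Prop. 9.5.1 (a) p. 149, chunk p0143] -/
theorem ExtendsToSmooth.of_smooth {Smooth : (M → ℂ) → Prop} {D : M → Prop} {R : M → ℂ} (h : Smooth R) :
    ExtendsToSmooth Smooth D R :=
  ⟨R, h, fun _ _ => rfl⟩

omit [TopologicalSpace M] in
/-- Shrinking the set on which agreement is demanded preserves «extends to a smooth function».
[cite: Rogawski1990, §9.5 Prop. 9.5.1 (a) p. 149, chunk p0143] -/
theorem ExtendsToSmooth.mono {Smooth : (M → ℂ) → Prop} {D D' : M → Prop} {R : M → ℂ} (h : ExtendsToSmooth Smooth D R)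
    (hD : ∀ γ, D' γ → D γ) : ExtendsToSmooth Smooth D' R := by
  obtain ⟨g, hg, hagree⟩ := h
  exact ⟨g, hg, fun γ hγ => hagree γ (hD γ hγ)⟩

variable {TG TH : Type u₁}

/-- **Global ⇒ germwise**: if `F` extends to a locally constant function on `M` agreeing with `F` at the regular elements (t12's currency, at
`Smooth := IsSmoothPadic`, `D := 𝔇.IsRegular`), then `F` «extends to a smooth function of `γ` near `γ₀`» for every `γ₀` in t05's currency
`U3SingularityData.ExtendsSmoothNear`. [cite: Rogawski1990, §9.2 Lemma 9.2.3 p. 140, chunk p0136; Prop. 9.2.5 p. 141, chunk p0137] -/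
theorem extendsSmoothNear_of_extendsToSmooth (𝔇 : U3SingularityData M TG TH) {F : M → ℂ}
    (h : ExtendsToSmooth IsSmoothPadic 𝔇.IsRegular F) (γ₀ : M) : 𝔇.ExtendsSmoothNear F γ₀ := by
  obtain ⟨g, hg, hagree⟩ := h
  exact ⟨g, isSmoothNear_of_isSmoothPadic hg γ₀, Filter.Eventually.of_forall fun γ hγ => hagree γ hγ⟩

/-- **PROP. 9.2.5 (last sentence) in t12's currency**: t05's `Prop925Smooth` says exactly that `S𝔍(·, f)` (for a matching `f^H` and `f` stably
equivalent to zero) `ExtendsToSmooth` with the `p`-adic smoothness class on the regular set. [cite: Rogawski1990, §9.2 Prop. 9.2.5 p. 141, chunk p0137] -/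
theorem prop925Smooth_iff (𝔇 : U3SingularityData M TG TH) :
    𝔇.Prop925Smooth ↔ ∀ (f : TG) (fH : TH), 𝔇.MatchH f fH → 𝔇.IsStablyEquivZero f →
      ExtendsToSmooth IsSmoothPadic 𝔇.IsRegular (𝔇.SJ f fH) :=
  Iff.rfl

/-- From t05's `Prop925Smooth`, the germ statement at every `γ₀`. [cite: Rogawski1990, §9.2 Prop. 9.2.5 p. 141, chunk p0137] -/
theorem extendsSmoothNear_SJ_of_prop925Smooth (𝔇 : U3SingularityData M TG TH) (h : 𝔇.Prop925Smooth) {f : TG} {fH : TH}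
    (hm : 𝔇.MatchH f fH) (h0 : 𝔇.IsStablyEquivZero f) (γ₀ : M) : 𝔇.ExtendsSmoothNear (𝔇.SJ f fH) γ₀ :=
  extendsSmoothNear_of_extendsToSmooth 𝔇 (h f fH hm h0) γ₀

variable {TG₁ : Type u₁}

/-- **PROP. 9.3.2 (archimedean, posited `IsSmooth`) ⇒ t12-style extension** on any set `D`. [cite: Rogawski1990, §9.3 Prop. 9.3.2 p. 144, chunk p0139] -/
theorem prop932_extendsToSmooth (𝔇 : RealSingularityData M TG TH TG₁) (h : 𝔇.Prop932) {f : TG} {fH : TH} (hm : 𝔇.MatchH f fH)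
    (h0 : 𝔇.IsStablyEquivZero f) (D : M → Prop) : ExtendsToSmooth 𝔇.IsSmooth D (𝔇.SJ f fH) :=
  ExtendsToSmooth.of_smooth (h f fH hm h0)

/-- **PROP. 9.3.1 (archimedean, `U(2)` ∕ `U(2) × U(1)`) ⇒ t12-style extension** on any set `D`. [cite: Rogawski1990, §9.3 Prop. 9.3.1 p. 143, chunk p0138] -/
theorem prop931_extendsToSmooth (𝔇 : RealSingularityData M TG TH TG₁) (h : 𝔇.Prop931) {f : TH} (h0 : 𝔇.IsStablyEquivZeroH f)
    (D : M → Prop) : ExtendsToSmooth 𝔇.IsSmooth D (𝔇.JH f) :=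
  ExtendsToSmooth.of_smooth (h f h0)

end Smooth

/-! ## §2 t12's own §9.4 statement in the same currency -/

section Split

variable {G : Type u} [Group G] {M : Type v} [TopologicalSpace M]
variable [∀ γ : G, MeasurableSpace (G ⧸ Subgroup.centralizer ({γ} : Set G))]

/-- **PROP. 9.4.1 ⇒ extension**: at a split place, `S𝔍(·, f)` (already a smooth function on all of `M` by `Prop941`) extends itself on any set `D`.
[cite: Rogawski1990, §9.4 Prop. 9.4.1 p. 147, chunk p0141] -/
theorem prop941_extendsToSmooth (𝔡 : SplitSingularityData G M) {m : Literature.NumberTheory.Automorphic.OrbitalMeasureFamily G}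
    {Smooth : (M → ℂ) → Prop} (h : 𝔡.Prop941 m Smooth) {f : G → ℂ} (hf : 𝔡.C f) (h0 : 𝔡.StablyZeroSplit m f) (D : M → Prop) :
    ExtendsToSmooth Smooth D (𝔡.SJ f) :=
  ExtendsToSmooth.of_smooth (h f hf h0)

end Split

/-! ## §3 (9.5.1) against `S𝔍` -/

section Twisted

variable {Gt : Type u₁} {G H : Type u₂} {M : Type v} [TopologicalSpace M] {TG₁ : Type u₂}

/-- **(9.5.1) = `𝔍_ε(δ_v, φ_v) − S𝔍(γ, f) − ½ 𝔍_H(γ, φ^H)`** — print's DEFINITION of `R(γ, φ, v)` («`𝔍_{M̃}(δ, φ, v) − S𝔍_M(γ, f, v) − ½ S𝔍_M(γ, φ^H, v)`»,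
with `S𝔍` for `H` being `𝔍_H`) recovered from the expanded local expression (9.5.1) typed by t12, once the twisted datum's `𝔍`, `𝔍_H` and `μ(γ)⁻¹` are
those of an archimedean §9.3 datum of t05 on the same `M` and the same test-function types (`TG := G → ℂ`, `TH := H → ℂ`).
[cite: Rogawski1990, §9.5 (9.5.1) p. 149, chunk p0143; §9.2 p. 141, chunk p0137] -/
theorem localR_eq_Jt_sub_SJ (𝔡 : TwistedSingularityData Gt G H M) (𝔇 : RealSingularityData M (G → ℂ) (H → ℂ) TG₁)
    (hJ : ∀ (f : G → ℂ) (γ : M), 𝔡.J f γ = 𝔇.J f γ) (hJH : ∀ (h : H → ℂ) (γ : M), 𝔡.JH h γ = 𝔇.JH h γ)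
    (hμ : ∀ γ : M, 𝔡.muInv γ = (𝔇.muFactor γ)⁻¹) (φ : Gt → ℂ) (f : G → ℂ) (φH fH : H → ℂ) (γ : M) :
    𝔡.localR φ f φH fH γ = 𝔡.Jt φ γ - 𝔇.SJ f fH γ - 1 / 2 * 𝔇.JH φH γ := by
  simp only [TwistedSingularityData.localR, RealSingularityData.SJ, hJ, hJH, hμ]
  ring

variable {TG TH : Type u₂}

/-- The same identity against t05's `p`-adic §9.2 datum (`U3SingularityData.SJ`, whose `𝔍_H` is the field `H.J` of its §9.1 sub-datum).
[cite: Rogawski1990, §9.5 (9.5.1) p. 149, chunk p0143; §9.2 p. 141, chunk p0137] -/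
theorem localR_eq_Jt_sub_SJ' (𝔡 : TwistedSingularityData Gt G H M) (𝔇 : U3SingularityData M (G → ℂ) (H → ℂ))
    (hJ : ∀ (f : G → ℂ) (γ : M), 𝔡.J f γ = 𝔇.J f γ) (hJH : ∀ (h : H → ℂ) (γ : M), 𝔡.JH h γ = 𝔇.H.J h γ)
    (hμ : ∀ γ : M, 𝔡.muInv γ = (𝔇.muFactor γ)⁻¹) (φ : Gt → ℂ) (f : G → ℂ) (φH fH : H → ℂ) (γ : M) :
    𝔡.localR φ f φH fH γ = 𝔡.Jt φ γ - 𝔇.SJ f fH γ - 1 / 2 * 𝔇.H.J φH γ := by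
  simp only [TwistedSingularityData.localR, U3SingularityData.SJ, hJ, hJH, hμ]
  ring

end Twisted

end Literature.NumberTheory.Rogawski1990.Ch9Bridge
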